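import Mathlib
import HarnessLib
import Literature.Geometry.DiscreteGeometry.TammesThirteen

/-!
# The twelve link directions surround the centre (`0 ∈ interior (conv X)`), from Tammes-13

Route `PricedLinkCensus`, item `SoftFourRings` (stmt-AtomisticToContinuum-14234), evidence
`softrings-search.md` §12.  The hypothesis `0 ∈ interior (conv X)` of the tree's Euler formula for
spherical subdivisions (`Literature.Geometry.DiscreteGeometry.euler_formula`, `card_hullEdges_le`)
holds for twelve unit vectors with pairwise angular separation `≥ 59.35°` (chord `≥ 0.99`):
otherwise they lie in a closed hemisphere, and the opposite pole is at chordal distance `≥ √2` from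
all of them — a thirteenth point, contradicting Tammes' problem for `N = 13` (every `13` unit vectors
contain two at chord distance `< 0.957`, i.e. angle `< 57.17°`; tree NAMED FACT
`musinTarasov2012_tammes_thirteen`, Musin–Tarasov 2012, computer-assisted).  This is the "shift to
the pole of an empty hemisphere" of Musin–Tarasov §2.1 (tree: `hasShift_of_forall_inner_nonneg`,
`IsTammesOptimal.zero_mem_interior_convexHull`, whose Hahn–Banach step is adapted here to an
arbitrary finite set).  The results taking `musinTarasov2012_tammes_thirteen` as a hypothesis are
CONDITIONAL on that named fact.
-/

namespace Summit.AtomisticToContinuum.Crystallization.Theorems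

open Real RealInnerProductSpace Literature.Geometry.DiscreteGeometry

/-- **A finite set meeting every open half-space through `0` spans affinely.**  If for every
`v ≠ 0` some `x ∈ S` has `⟪v, x⟫ < 0`, then `affineSpan ℝ S = ⊤`. (Adapted from the tree's
`IsTammesOptimal.affineSpan_eq_top`.) [folklore] -/
theorem affineSpan_eq_top_of_forall_exists_inner_neg {E : Type*} [NormedAddCommGroup E]
    [InnerProductSpace ℝ E] [FiniteDimensional ℝ E] {S : Set E} (hS : S.Nonempty)
    (h : ∀ v : E, v ≠ 0 → ∃ x ∈ S, ⟪v, x⟫ < 0) : affineSpan ℝ S = ⊤ := by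
  obtain ⟨x₀, hx₀⟩ := hS
  have hne : (affineSpan ℝ S : Set E).Nonempty := ⟨x₀, mem_affineSpan ℝ hx₀⟩
  rw [← AffineSubspace.direction_eq_top_iff_of_nonempty hne, ← Submodule.orthogonal_eq_bot_iff]
  by_contra hbot
  obtain ⟨v, hv, hv0⟩ := Submodule.exists_mem_ne_zero_of_ne_bot hbot
  have hconst : ∀ x ∈ S, ⟪v, x⟫ = ⟪v, x₀⟫ := by
    intro x hx
    have hmem : x -ᵥ x₀ ∈ (affineSpan ℝ S).direction :=
      AffineSubspace.vsub_mem_direction (mem_affineSpan ℝ hx) (mem_affineSpan ℝ hx₀)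
    have h0 : ⟪v, x -ᵥ x₀⟫ = 0 := by
      rw [real_inner_comm]
      exact (Submodule.mem_orthogonal _ v).1 hv _ hmem
    rwa [vsub_eq_sub, inner_sub_right, sub_eq_zero] at h0
  rcases le_or_gt 0 ⟪v, x₀⟫ with hc | hc
  · obtain ⟨x, hx, hj⟩ := h v hv0
    rw [hconst x hx] at hj
    exact absurd hc (not_le.2 hj)
  · obtain ⟨x, hx, hj⟩ := h (-v) (neg_ne_zero.2 hv0)
    rw [inner_neg_left, hconst x hx, neg_lt_zero] at hj
    exact absurd hc (not_lt.2 hj.le)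

/-- **A finite set meeting every open half-space through `0` has `0` in the interior of its convex
hull.**  (Hahn–Banach separation; adapted from the tree's
`IsTammesOptimal.zero_mem_interior_convexHull`.) [folklore] -/
theorem zero_mem_interior_convexHull_of_forall_exists_inner_neg {E : Type*}
    [NormedAddCommGroup E] [InnerProductSpace ℝ E] [FiniteDimensional ℝ E] {S : Set E}
    (hS : S.Nonempty) (h : ∀ v : E, v ≠ 0 → ∃ x ∈ S, ⟪v, x⟫ < 0) :
    (0 : E) ∈ interior (convexHull ℝ S) := by
  set C := convexHull ℝ S with hC
  have hCconv : Convex ℝ C := convex_convexHull ℝ _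
  have hint : (interior C).Nonempty :=
    interior_convexHull_nonempty_iff_affineSpan_eq_top.2
      (affineSpan_eq_top_of_forall_exists_inner_neg hS h)
  by_contra h0
  obtain ⟨f, hf⟩ := geometric_hahn_banach_open_point hCconv.interior isOpen_interior h0
  rw [map_zero] at hf
  have hle : ∀ x ∈ S, f x ≤ 0 := by
    intro x hx
    have hxC : x ∈ closure (interior C) := by
      rw [hCconv.closure_interior_eq_closure_of_nonempty_interior hint]
      exact subset_closure (subset_convexHull ℝ _ hx)
    have hclosed : IsClosed {a : E | f a ≤ 0} := isClosed_le f.continuous continuous_const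
    exact (hclosed.closure_subset_iff.2 fun a ha => (hf a ha).le) hxC
  set w : E := (InnerProductSpace.toDual ℝ E).symm f with hw
  have hfw : ∀ a, f a = ⟪w, a⟫ := fun a => by rw [hw, InnerProductSpace.toDual_symm_apply]
  have hw0 : w ≠ 0 := by
    intro h'
    obtain ⟨p, hp⟩ := hint
    have := hf p hp
    rw [hfw, h', inner_zero_left] at this
    exact lt_irrefl _ this
  obtain ⟨x, hx, hj⟩ := h (-w) (neg_ne_zero.2 hw0)
  have := hle x hx
  rw [hfw] at this
  rw [inner_neg_left, neg_lt_zero] at hj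
  linarith

/-- **Twelve well-separated unit vectors meet every open hemisphere** (conditional on Tammes-13).
If `X` consists of at least twelve unit vectors of `ℝ³` with pairwise chordal distances `≥ 0.957`
and all of them satisfied `⟪v, x⟫ ≥ 0` for some `v ≠ 0`, the pole `−v/‖v‖` would be a thirteenth
point at distance `≥ √2` from each — impossible by `musinTarasov2012_tammes_thirteen`.
[cite: MusinTarasov2012, Theorem 1 and §2.1] -/
theorem exists_inner_neg_of_twelve_le_card (hT : musinTarasov2012_tammes_thirteen)
    {X : Finset (EuclideanSpace ℝ (Fin 3))} (hX1 : ∀ y ∈ X, ‖y‖ = 1) (hcard : 12 ≤ X.card)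
    (hsep : ∀ u ∈ X, ∀ v ∈ X, u ≠ v → (0.957 : ℝ) ≤ dist u v)
    {v : EuclideanSpace ℝ (Fin 3)} (hv : v ≠ 0) : ∃ x ∈ X, ⟪v, x⟫ < 0 := by
  classical
  by_contra hcon
  push Not at hcon
  set p : EuclideanSpace ℝ (Fin 3) := (-‖v‖⁻¹) • v with hp
  have hvn : 0 < ‖v‖ := norm_pos_iff.2 hv
  have hp1 : ‖p‖ = 1 := by
    rw [hp, norm_smul, norm_neg, norm_inv, norm_norm, inv_mul_cancel₀ hvn.ne']
  have hpx : ∀ x ∈ X, ⟪p, x⟫ ≤ 0 := by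
    intro x hx
    rw [hp, real_inner_smul_left]
    exact mul_nonpos_of_nonpos_of_nonneg (neg_nonpos.2 (inv_nonneg.2 hvn.le)) (hcon x hx)
  have hpX : p ∉ X := by
    intro hpX'
    have h1 := hpx p hpX'
    rw [real_inner_self_eq_norm_sq, hp1] at h1
    norm_num at h1
  have hdist : ∀ x ∈ X, Real.sqrt 2 ≤ dist p x := by
    intro x hx
    have hd : dist p x ^ 2 = 2 - 2 * ⟪p, x⟫ := by
      rw [dist_eq_norm, ← real_inner_self_eq_norm_sq, inner_sub_left, inner_sub_right,
        inner_sub_right, real_inner_self_eq_norm_sq, real_inner_self_eq_norm_sq, hp1, hX1 x hx,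
        real_inner_comm p x]
      ring
    have h2 : (2 : ℝ) ≤ dist p x ^ 2 := by rw [hd]; linarith [hpx x hx]
    calc Real.sqrt 2 ≤ Real.sqrt (dist p x ^ 2) := Real.sqrt_le_sqrt h2
      _ = dist p x := Real.sqrt_sq dist_nonneg
  have h957 : (0.957 : ℝ) ≤ Real.sqrt 2 := by
    rw [show (0.957 : ℝ) = Real.sqrt (0.957 ^ 2) by rw [Real.sqrt_sq]; norm_num]
    exact Real.sqrt_le_sqrt (by norm_num)
  have hcard' : (insert p X).card = X.card + 1 := Finset.card_insert_of_notMem hpX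
  have hle := hT (insert p X) (fun y hy => by
      rcases Finset.mem_insert.1 hy with rfl | hy
      · exact hp1
      · exact hX1 y hy)
    (fun a ha b hb hab => by
      rcases Finset.mem_insert.1 ha with rfl | ha <;> rcases Finset.mem_insert.1 hb with rfl | hb
      · exact absurd rfl hab
      · exact h957.trans (hdist b hb)
      · rw [dist_comm]; exact h957.trans (hdist a ha)
      · exact hsep a ha b hb hab)
  omega

/-- **The twelve link directions surround the centre** (conditional on Tammes-13): twelve or more
unit vectors of `ℝ³` with pairwise inner products `≤ ca`, `2 ca ≤ 2 − 0.957²` (e.g. the soft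
separation `ca = 1 − 1/(2·(101/100)²) ≈ 0.51` of `softFourRings_of_twelve_unit`), have `0` in the
interior of their convex hull — the standing hypothesis of the tree's `euler_formula` /
`card_hullEdges_le` for spherical subdivisions. [cite: MusinTarasov2012, Theorem 1 and §3.2] -/
theorem zero_mem_interior_convexHull_of_twelve_le_card (hT : musinTarasov2012_tammes_thirteen)
    {X : Finset (EuclideanSpace ℝ (Fin 3))} (hX1 : ∀ y ∈ X, ‖y‖ = 1) (hcard : 12 ≤ X.card)
    {ca : ℝ} (hca : 2 * ca ≤ 2 - 0.957 ^ 2) (hsep : ∀ u ∈ X, ∀ v ∈ X, u ≠ v → ⟪u, v⟫ ≤ ca) :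
    (0 : EuclideanSpace ℝ (Fin 3)) ∈
      interior (convexHull ℝ (X : Set (EuclideanSpace ℝ (Fin 3)))) := by
  have hX : (X : Set (EuclideanSpace ℝ (Fin 3))).Nonempty := by
    have : X.Nonempty := Finset.card_pos.1 (by omega)
    exact this.coe_sort.elim fun x => ⟨x.1, x.2⟩
  have hdist : ∀ u ∈ X, ∀ v ∈ X, u ≠ v → (0.957 : ℝ) ≤ dist u v := by
    intro u hu v hv huv
    have hd : dist u v ^ 2 = 2 - 2 * ⟪u, v⟫ := by
      rw [dist_eq_norm, ← real_inner_self_eq_norm_sq, inner_sub_left, inner_sub_right,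
        inner_sub_right, real_inner_self_eq_norm_sq, real_inner_self_eq_norm_sq, hX1 u hu,
        hX1 v hv, real_inner_comm u v]
      ring
    have h2 : (0.957 : ℝ) ^ 2 ≤ dist u v ^ 2 := by
      rw [hd]; linarith [hsep u hu v hv huv]
    exact (pow_le_pow_iff_left₀ (by norm_num) dist_nonneg two_ne_zero).1 h2
  exact zero_mem_interior_convexHull_of_forall_exists_inner_neg hX fun v hv =>
    exists_inner_neg_of_twelve_le_card hT hX1 hcard hdist hv

end Summit.AtomisticToContinuum.Crystallization.Theorems
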